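import Mathlib
import HarnessLib
import Summits.FinalStateConjecture.Statement
import Literature.Geometry.Lorentzian.Geodesic
import Literature.Geometry.Lorentzian.Curvature
import Literature.Geometry.Lorentzian.LeviCivita
import Literature.Geometry.Lorentzian.NullInfinity
import Literature.Geometry.Lorentzian.Causality
import Literature.Geometry.Lorentzian.TameGenericityLocal

/-!
# Route CurvatureOrSymmetry — the Assembly, frame form (item stmt-FinalStateConjecture-10214)

The assembly item of route `CurvatureOrSymmetry` for the Final State Conjecture is the curried
implication

`MGHDExistence → LocalExitSuffices → NoFourthExit → NoVacuumFountains → CurvatureModeExit →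
CensoredDataExit → FinalStateConjecture`,

literally the type of the route file's sorry-free deciding theorem
`Summit.FinalStateConjecture.FinalStateConjecture.Theses.CurvatureOrSymmetry.closes`.

Design constraint (why this file does NOT import the route module
`Summits.FinalStateConjecture.FinalStateConjecture.Theses.CurvatureOrSymmetry`; same pattern as
`Theorems/EIHFluxBalanceAssemblyFrame.lean`, `Theorems/PhotonSphereChannelsAssemblyFrameR.lean`,
`Theorems/SwallowTheDatumAssemblyFrame.lean`): when an item closes, the gate re-renders the route file
with `import <closing module>` and `theorem Assembly_holds : Assembly := …`; a closing module that
itself imports the route module cannot be re-imported there (import cycle), and a proof written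
`:= closes` against the route file breaks in the full build as soon as the planner restates an item
under the same decl name (this route's two-layer plan foresees exactly such a restatement:
`SymmetryModeExit` replacing `NoVacuumFountains`). So the theorem below states the six hypotheses
INLINED VERBATIM (the bodies of `MGHDExistence`, `LocalExitSuffices`, `NoFourthExit`,
`NoVacuumFountains`, `CurvatureModeExit`, `CensoredDataExit`, copied mechanically from the route file
rev 1, one physical line each), so that its type is the route decl `…Theses.CurvatureOrSymmetry.Assembly`
by `δ`-unfolding alone, it depends only on the Statement and the Lorentzian prelude, and the route
file can import this module without a cycle.

The proof is pure logic, the body of the route's deciding theorem `closes`: fix `X` and an admissible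
datum `D` exceptional for the Statement's property; by `LocalExitSuffices` a LOCAL good exit through
`D` (members with `0 < ‖c‖ < ε` good) suffices. If every maximal vacuum Cauchy development of `D` has
complete future null infinity, `D` is censored: `MGHDExistence` gives an MGHD, exceptionality of `D`
then yields an MGHD without exhaustive sub-extremal Kerr final-state decomposition of its
self-determined exterior, and `CensoredDataExit` supplies the exit family. Otherwise some MGHD `𝒟`
has incomplete `𝓘⁺`; `NoFourthExit` gives a visible future-incomplete null geodesic of `𝒟` ending by
curvature (a) or by symmetry (c); if (a) failed, (c) would hold and contradict `NoVacuumFountains`,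
so (classically) (a) holds and `CurvatureModeExit` supplies the exit family. In both cases the
members with `0 < ‖c‖ < ε` are good, hence outside the exceptional set `{d ∈ 𝓓 | ¬ P d}`. The
instance binder `∀ [𝒟.metric.HasLeviCivita]` is threaded, never discharged. No analysis, no new
definitions; nothing here bears on the truth of the four cruxes.

## Re-type T2 (2026-08-16) — the repaired frame `CurvatureOrSymmetry.assemblyT2_frame_proof`

On 2026-08-16 the summit statement `FinalStateConjecture` was RE-TYPED (statement-revised p126844,
re-type T2): genericity is now the TAME notion `InitialDataSet.IsTameChristodoulouGeneric` (one
fixed end `e : AFEnd X`, `IsTameDataFamily e 1 F ∧ IsImmersedAtZero 1 F`), and the post-maximality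
conclusion gained the clauses `Summit.FinalStateConjecture.RaysStayInClosure 𝒟 O` and
`Summit.FinalStateConjecture.IsFutureOriented d`. The rev-1 frame theorem
`CurvatureOrSymmetry.assembly_frame_proof` (six rev-1 bodies `→ FinalStateConjecture`) therefore no
longer elaborates (full build 2026-08-16: type mismatch `IsSmoothDataFamily … / ∃ e, IsTameDataFamily e …`
at its `refine hL X _ D ?_`), and its item stmt-FinalStateConjecture-10214 was retired by the route
repair (rev 2, 23:16Z; rev 5, 23:33Z). The route's CURRENT assembly is item
stmt-FinalStateConjecture-17756, `NoFourthExit → NoVacuumFountains → TameCurvatureModeExit →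
TameCensoredDataExit → MGHDExistence → FinalStateConjecture` (crux-only; the local-to-global
reparametrisation is the Literature lemma `InitialDataSet.isTameChristodoulouGeneric_of_local`,
`Literature/Geometry/Lorentzian/TameGenericityLocal.lean`). The theorem
`CurvatureOrSymmetry.assemblyT2_frame_proof` below states these FIVE hypotheses inlined verbatim (bodies
of `NoFourthExit`, `NoVacuumFountains`, `TameCurvatureModeExit`, `TameCensoredDataExit`, `MGHDExistence`
copied mechanically from the route file rev 6, one physical line each), so that its type is the route
decl `…Theses.CurvatureOrSymmetry.Assembly` (stmt-FinalStateConjecture-17756) by `δ`-unfolding alone, under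
the same Theses-free design constraint as above; its proof is the body of the route's rev-5 deciding
theorem `closes`, verbatim. The old name survives as a deprecated alias (Theorems files are append-only).
-/

-- every `Summit.FinalStateConjecture.FinalStateConjecture.…` name repeats the summit = sub-problem
-- segment (D-0017 layout, CONVENTIONS §2; lakefile sets it for the library build, a standalone
-- elaboration of this file does not see that option); the duplicate is deliberate.
set_option linter.dupNamespace false

namespace Summit.FinalStateConjecture.FinalStateConjecture.Theorems

open scoped BigOperators Topology Manifold Classical MeasureTheory ProbabilityTheory Matrix InnerProductSpace ComplexConjugate ContinuousMap
open Filter Set Function TopologicalSpace MeasureTheory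

/-- **Assembly of route CurvatureOrSymmetry, frame form, re-typed for the T2 summit statement**
(item stmt-FinalStateConjecture-17756): `NoFourthExit → NoVacuumFountains → TameCurvatureModeExit →
TameCensoredDataExit → MGHDExistence → FinalStateConjecture`, the five hypotheses written out verbatim —
an MGHD of admissible data with incomplete `𝓘⁺` contains a visible future-incomplete null geodesic ending
(a) by p.p.-curvature blow-up or (c) with a Killing-horizon shadow; (c) never occurs without (a); data
owning such a curvature-singular visible ray admit a local TAME exit (immersed admissible curve on
one end whose members with `0 < ‖c‖ < ε` are good for the 5-conjunct T2 property); censored exceptional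
data admit a local tame exit; every admissible datum has an MGHD — so that this type unfolds to the route decl
`Summit.FinalStateConjecture.FinalStateConjecture.Theses.CurvatureOrSymmetry.Assembly` by `δ`-reduction
alone. Proof: the route's rev-5 deciding theorem `closes`, verbatim — tame genericity is local in the
parameter (`InitialDataSet.isTameChristodoulouGeneric_of_local`), so it suffices to exit locally through
every exceptional admissible datum `D`; case split on whether every MGHD of `D` has complete `𝓘⁺`:
censored case via `MGHDExistence` + `TameCensoredDataExit`, naked case via `NoFourthExit`,
`NoVacuumFountains` (excluded middle on alternative (a)) and `TameCurvatureModeExit`. The instance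
binder `∀ [𝒟.metric.HasLeviCivita]` is threaded, never discharged. -/
theorem CurvatureOrSymmetry.assemblyT2_frame_proof :
    (∀ (X : Type) [TopologicalSpace X] [ChartedSpace Literature.Geometry.Lorentzian.E3 X] [IsManifold (𝓡 3) ((⊤ : ℕ∞) : WithTop ℕ∞) X] [T2Space X] [SecondCountableTopology X] [ConnectedSpace X], ∀ D ∈ Literature.Geometry.Lorentzian.admissibleVacuumData X, ∀ 𝒟 : Literature.Geometry.Lorentzian.VacuumCauchyDevelopment D, 𝒟.IsMaximal → ¬ Summit.FinalStateConjecture.HasCompleteNullInfinity 𝒟.toCauchyDevelopment → ∀ [𝒟.metric.HasLeviCivita], ∃ (γ : ℝ → 𝒟.carrier) (dom : Set ℝ), (Literature.Geometry.Lorentzian.IsMaximalGeodesicOn 𝒟.metric.leviCivita γ dom ∧ (0 : ℝ) ∈ dom ∧ BddAbove dom ∧ (∀ t ∈ dom, 𝒟.metric.IsNull (Literature.Geometry.Lorentzian.velocity (𝓡 4) γ t) ∧ 𝒟.timeOrientation.IsFutureDirected (Literature.Geometry.Lorentzian.velocity (𝓡 4) γ t)) ∧ (∀ t ∈ dom, 0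 ≤ t → (∃ (p : X) (δ : ℝ → 𝒟.carrier) (s : Set ℝ), 𝒟.metric.IsNormalisedNullRayFrom 𝒟.timeOrientation 𝒟.embed 𝒟.normal p δ s ∧ ¬ BddAbove s ∧ γ t ∈ 𝒟.metric.chronologicalPast 𝒟.timeOrientation (δ '' (s ∩ Set.Ici 0))))) ∧ ((∃ e : Fin 4 → (Π t : ℝ, TangentSpace (𝓡 4) (γ t)), (∀ a, ∀ t ∈ dom, MDifferentiableAt 𝓘(ℝ, ℝ) (𝓡 4).tangent (fun s : ℝ ↦ (Bundle.TotalSpace.mk' Literature.Geometry.Lorentzian.E4 (γ s) (e a s) : TangentBundle (𝓡 4) 𝒟.carrier)) t ∧ Literature.Geometry.Lorentzian.covariantDerivAlong 𝒟.metric.leviCivita γ (e a) t = 0) ∧ LinearIndependent ℝ (fun a ↦ e a 0) ∧ ∀ C : ℝ, ∃ t ∈ dom, 0 ≤ t ∧ ∃ a b c d : Fin 4, C < |𝒟.metric.val (γ t) (CovariantDerivative.curvature 𝒟.metric.leviCivita (γ t) (e a t) (e b t) (e c t)) (e d t)|) ∨ (∃ (U : Set 𝒟.carrier) (K : Π x :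 𝒟.carrier, TangentSpace (𝓡 4) x) (t₀ : ℝ), IsOpen U ∧ t₀ ∈ dom ∧ (∀ t ∈ dom, t₀ ≤ t → γ t ∈ U) ∧ ContMDiffOn (𝓡 4) ((𝓡 4).prod 𝓘(ℝ, Literature.Geometry.Lorentzian.E4)) ((⊤ : ℕ∞) : WithTop ℕ∞) (fun x ↦ (Bundle.TotalSpace.mk' Literature.Geometry.Lorentzian.E4 x (K x) : TangentBundle (𝓡 4) 𝒟.carrier)) U ∧ (∀ x ∈ U, ∀ v w : TangentSpace (𝓡 4) x, 𝒟.metric.val x (𝒟.metric.leviCivita K x v) w + 𝒟.metric.val x v (𝒟.metric.leviCivita K x w) = 0) ∧ (∀ t ∈ dom, t₀ ≤ t → 𝒟.metric.val (γ t) (K (γ t)) (Literature.Geometry.Lorentzian.velocity (𝓡 4) γ t) = -1) ∧ Filter.Tendsto (fun t : ℝ ↦ 𝒟.metric.val (γ t) (K (γ t)) (K (γ t))) (nhdsWithin (sSup dom) dom) (nhds 0)))) →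
    (∀ (X : Type) [TopologicalSpace X] [ChartedSpace Literature.Geometry.Lorentzian.E3 X] [IsManifold (𝓡 3) ((⊤ : ℕ∞) : WithTop ℕ∞) X] [T2Space X] [SecondCountableTopology X] [ConnectedSpace X], ∀ D ∈ Literature.Geometry.Lorentzian.admissibleVacuumData X, ∀ 𝒟 : Literature.Geometry.Lorentzian.VacuumCauchyDevelopment D, 𝒟.IsMaximal → ∀ [𝒟.metric.HasLeviCivita], ¬ ∃ (γ : ℝ → 𝒟.carrier) (dom : Set ℝ), (Literature.Geometry.Lorentzian.IsMaximalGeodesicOn 𝒟.metric.leviCivita γ dom ∧ (0 : ℝ) ∈ dom ∧ BddAbove dom ∧ (∀ t ∈ dom, 𝒟.metric.IsNull (Literature.Geometry.Lorentzian.velocity (𝓡 4) γ t) ∧ 𝒟.timeOrientation.IsFutureDirected (Literature.Geometry.Lorentzian.velocity (𝓡 4) γ t)) ∧ (∀ t ∈ dom, 0 ≤ t → (∃ (p : X) (δ : ℝ → 𝒟.carrier) (s : Set ℝ), 𝒟.metric.IsNormalisedNullRayFrom 𝒟.timeOrientation 𝒟.embed 𝒟.normal p δ s ∧ ¬ BddAbove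 s ∧ γ t ∈ 𝒟.metric.chronologicalPast 𝒟.timeOrientation (δ '' (s ∩ Set.Ici 0))))) ∧ ¬ (∃ e : Fin 4 → (Π t : ℝ, TangentSpace (𝓡 4) (γ t)), (∀ a, ∀ t ∈ dom, MDifferentiableAt 𝓘(ℝ, ℝ) (𝓡 4).tangent (fun s : ℝ ↦ (Bundle.TotalSpace.mk' Literature.Geometry.Lorentzian.E4 (γ s) (e a s) : TangentBundle (𝓡 4) 𝒟.carrier)) t ∧ Literature.Geometry.Lorentzian.covariantDerivAlong 𝒟.metric.leviCivita γ (e a) t = 0) ∧ LinearIndependent ℝ (fun a ↦ e a 0) ∧ ∀ C : ℝ, ∃ t ∈ dom, 0 ≤ t ∧ ∃ a b c d : Fin 4, C < |𝒟.metric.val (γ t) (CovariantDerivative.curvature 𝒟.metric.leviCivita (γ t) (e a t) (e b t) (e c t)) (e d t)|) ∧ (∃ (U : Set 𝒟.carrier) (K : Π x : 𝒟.carrier, TangentSpace (𝓡 4) x) (t₀ : ℝ), IsOpen U ∧ t₀ ∈ dom ∧ (∀ t ∈ dom, t₀ ≤ t → γ t ∈ U) ∧ ContMDiffOn (𝓡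 4) ((𝓡 4).prod 𝓘(ℝ, Literature.Geometry.Lorentzian.E4)) ((⊤ : ℕ∞) : WithTop ℕ∞) (fun x ↦ (Bundle.TotalSpace.mk' Literature.Geometry.Lorentzian.E4 x (K x) : TangentBundle (𝓡 4) 𝒟.carrier)) U ∧ (∀ x ∈ U, ∀ v w : TangentSpace (𝓡 4) x, 𝒟.metric.val x (𝒟.metric.leviCivita K x v) w + 𝒟.metric.val x v (𝒟.metric.leviCivita K x w) = 0) ∧ (∀ t ∈ dom, t₀ ≤ t → 𝒟.metric.val (γ t) (K (γ t)) (Literature.Geometry.Lorentzian.velocity (𝓡 4) γ t) = -1) ∧ Filter.Tendsto (fun t : ℝ ↦ 𝒟.metric.val (γ t) (K (γ t)) (K (γ t))) (nhdsWithin (sSup dom) dom) (nhds 0))) →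
    (∀ (X : Type) [TopologicalSpace X] [ChartedSpace Literature.Geometry.Lorentzian.E3 X] [IsManifold (𝓡 3) ((⊤ : ℕ∞) : WithTop ℕ∞) X] [T2Space X] [SecondCountableTopology X] [ConnectedSpace X], ∀ D ∈ Literature.Geometry.Lorentzian.admissibleVacuumData X, (∃ 𝒟 : Literature.Geometry.Lorentzian.VacuumCauchyDevelopment D, 𝒟.IsMaximal ∧ ¬ Summit.FinalStateConjecture.HasCompleteNullInfinity 𝒟.toCauchyDevelopment ∧ ∀ [𝒟.metric.HasLeviCivita], ∃ (γ : ℝ → 𝒟.carrier) (dom : Set ℝ), (Literature.Geometry.Lorentzian.IsMaximalGeodesicOn 𝒟.metric.leviCivita γ dom ∧ (0 : ℝ) ∈ dom ∧ BddAbove dom ∧ (∀ t ∈ dom, 𝒟.metric.IsNull (Literature.Geometry.Lorentzian.velocity (𝓡 4) γ t) ∧ 𝒟.timeOrientation.IsFutureDirected (Literature.Geometry.Lorentzian.velocity (𝓡 4) γ t)) ∧ (∀ t ∈ dom, 0 ≤ t → (∃ (p : X) (δ : ℝ → 𝒟.carrier) (s : Set ℝ), 𝒟.metric.IsNormalisedNullRayFrom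 𝒟.timeOrientation 𝒟.embed 𝒟.normal p δ s ∧ ¬ BddAbove s ∧ γ t ∈ 𝒟.metric.chronologicalPast 𝒟.timeOrientation (δ '' (s ∩ Set.Ici 0))))) ∧ (∃ e : Fin 4 → (Π t : ℝ, TangentSpace (𝓡 4) (γ t)), (∀ a, ∀ t ∈ dom, MDifferentiableAt 𝓘(ℝ, ℝ) (𝓡 4).tangent (fun s : ℝ ↦ (Bundle.TotalSpace.mk' Literature.Geometry.Lorentzian.E4 (γ s) (e a s) : TangentBundle (𝓡 4) 𝒟.carrier)) t ∧ Literature.Geometry.Lorentzian.covariantDerivAlong 𝒟.metric.leviCivita γ (e a) t = 0) ∧ LinearIndependent ℝ (fun a ↦ e a 0) ∧ ∀ C : ℝ, ∃ t ∈ dom, 0 ≤ t ∧ ∃ a b c d : Fin 4, C < |𝒟.metric.val (γ t) (CovariantDerivative.curvature 𝒟.metric.leviCivita (γ t) (e a t) (e b t) (e c t)) (e d t)|)) → ∃ (e : Literature.Geometry.Lorentzian.AFEnd X) (F : EuclideanSpace ℝ (Fin 1) → Literature.Geometry.Lorentzian.InitialDataSet (𝓡 3) X), Literature.Geometry.Lorentzian.InitialDataSet.IsTameDataFamily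 e 1 F ∧ Literature.Geometry.Lorentzian.InitialDataSet.IsImmersedAtZero 1 F ∧ F 0 = D ∧ Function.Injective F ∧ (∀ c, F c ∈ Literature.Geometry.Lorentzian.admissibleVacuumData X) ∧ ∃ ε : ℝ, 0 < ε ∧ ∀ c, c ≠ 0 → ‖c‖ < ε → ((∃ 𝒟 : Literature.Geometry.Lorentzian.VacuumCauchyDevelopment (F c), 𝒟.IsMaximal) ∧ ∀ 𝒟 : Literature.Geometry.Lorentzian.VacuumCauchyDevelopment (F c), 𝒟.IsMaximal → Summit.FinalStateConjecture.HasCompleteNullInfinity 𝒟.toCauchyDevelopment ∧ ∃ (O : Set 𝒟.carrier) (d : Literature.Geometry.Lorentzian.FinalStateDecomposition 𝒟.toSpacetime O 2), (∀ i, Literature.Geometry.Lorentzian.Kerr.IsSubextremal (d.mass i) (d.spin i)) ∧ O = Summit.FinalStateConjecture.exteriorOf 𝒟.toCauchyDevelopment d.charted ∧ Summit.FinalStateConjecture.RaysStayInClosure 𝒟.toCauchyDevelopment O ∧ Summit.FinalStateConjecture.HasExhaustiveCharts d ∧ Summit.FinalStateConjecture.IsFutureOriented d)) →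
    (∀ (X : Type) [TopologicalSpace X] [ChartedSpace Literature.Geometry.Lorentzian.E3 X] [IsManifold (𝓡 3) ((⊤ : ℕ∞) : WithTop ℕ∞) X] [T2Space X] [SecondCountableTopology X] [ConnectedSpace X], ∀ D ∈ Literature.Geometry.Lorentzian.admissibleVacuumData X, (∃ 𝒟 : Literature.Geometry.Lorentzian.VacuumCauchyDevelopment D, 𝒟.IsMaximal) → (∀ 𝒟 : Literature.Geometry.Lorentzian.VacuumCauchyDevelopment D, 𝒟.IsMaximal → Summit.FinalStateConjecture.HasCompleteNullInfinity 𝒟.toCauchyDevelopment) → (∃ 𝒟 : Literature.Geometry.Lorentzian.VacuumCauchyDevelopment D, 𝒟.IsMaximal ∧ ¬ ∃ (O : Set 𝒟.carrier) (d : Literature.Geometry.Lorentzian.FinalStateDecomposition 𝒟.toSpacetime O 2), (∀ i, Literature.Geometry.Lorentzian.Kerr.IsSubextremal (d.mass i) (d.spin i)) ∧ O = Summit.FinalStateConjecture.exteriorOf 𝒟.toCauchyDevelopment d.charted ∧ Summit.FinalStateConjecture.RaysStayInClosure 𝒟.toCauchyDevelopment O ∧ Summit.FinalStateConjecture.HasExhaustiveCharts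 d ∧ Summit.FinalStateConjecture.IsFutureOriented d) → ∃ (e : Literature.Geometry.Lorentzian.AFEnd X) (F : EuclideanSpace ℝ (Fin 1) → Literature.Geometry.Lorentzian.InitialDataSet (𝓡 3) X), Literature.Geometry.Lorentzian.InitialDataSet.IsTameDataFamily e 1 F ∧ Literature.Geometry.Lorentzian.InitialDataSet.IsImmersedAtZero 1 F ∧ F 0 = D ∧ Function.Injective F ∧ (∀ c, F c ∈ Literature.Geometry.Lorentzian.admissibleVacuumData X) ∧ ∃ ε : ℝ, 0 < ε ∧ ∀ c, c ≠ 0 → ‖c‖ < ε → ((∃ 𝒟 : Literature.Geometry.Lorentzian.VacuumCauchyDevelopment (F c), 𝒟.IsMaximal) ∧ ∀ 𝒟 : Literature.Geometry.Lorentzian.VacuumCauchyDevelopment (F c), 𝒟.IsMaximal → Summit.FinalStateConjecture.HasCompleteNullInfinity 𝒟.toCauchyDevelopment ∧ ∃ (O : Set 𝒟.carrier) (d : Literature.Geometry.Lorentzian.FinalStateDecomposition 𝒟.toSpacetime O 2), (∀ i, Literature.Geometry.Lorentzian.Kerr.IsSubextremal (d.mass i) (d.spin i)) ∧ O = Summit.FinalStateConjecture.exteriorOf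 𝒟.toCauchyDevelopment d.charted ∧ Summit.FinalStateConjecture.RaysStayInClosure 𝒟.toCauchyDevelopment O ∧ Summit.FinalStateConjecture.HasExhaustiveCharts d ∧ Summit.FinalStateConjecture.IsFutureOriented d)) →
    (∀ (X : Type) [TopologicalSpace X] [ChartedSpace Literature.Geometry.Lorentzian.E3 X] [IsManifold (𝓡 3) ((⊤ : ℕ∞) : WithTop ℕ∞) X] [T2Space X] [SecondCountableTopology X] [ConnectedSpace X], ∀ D ∈ Literature.Geometry.Lorentzian.admissibleVacuumData X, ∃ 𝒟 : Literature.Geometry.Lorentzian.VacuumCauchyDevelopment D, 𝒟.IsMaximal) →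
    _root_.FinalStateConjecture := by
  intro hN hF hA hB hM X _ _ _ _ _ _
  refine Literature.Geometry.Lorentzian.InitialDataSet.isTameChristodoulouGeneric_of_local
    fun D hAdm hbad ↦ ?_
  by_cases hC : ∀ 𝒟 : Literature.Geometry.Lorentzian.VacuumCauchyDevelopment D, 𝒟.IsMaximal →
      _root_.Summit.FinalStateConjecture.HasCompleteNullInfinity 𝒟.toCauchyDevelopment
  · -- censored case: an MGHD exists, exceptionality of `D` gives a non-settling one
    obtain ⟨𝒟₀, h𝒟₀⟩ := hM X D hAdm
    have hns : ∃ 𝒟 : Literature.Geometry.Lorentzian.VacuumCauchyDevelopment D, 𝒟.IsMaximal ∧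
        ¬ ∃ (O : Set 𝒟.carrier) (d : Literature.Geometry.Lorentzian.FinalStateDecomposition 𝒟.toSpacetime O 2),
          (∀ i, Literature.Geometry.Lorentzian.Kerr.IsSubextremal (d.mass i) (d.spin i)) ∧
            O = _root_.Summit.FinalStateConjecture.exteriorOf 𝒟.toCauchyDevelopment d.charted ∧
              _root_.Summit.FinalStateConjecture.RaysStayInClosure 𝒟.toCauchyDevelopment O ∧
                _root_.Summit.FinalStateConjecture.HasExhaustiveCharts d ∧
                  _root_.Summit.FinalStateConjecture.IsFutureOriented d := by
      by_contra hcon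
      refine hbad ⟨⟨𝒟₀, h𝒟₀⟩, fun 𝒟 h𝒟 ↦ ⟨hC 𝒟 h𝒟, ?_⟩⟩
      by_contra hset
      exact hcon ⟨𝒟, h𝒟, hset⟩
    obtain ⟨e, F, hF, hI, h0, hinj, hadm, ε, hε, hgood⟩ := hB X D hAdm ⟨𝒟₀, h𝒟₀⟩ hC hns
    exact ⟨e, F, hF, hI, h0, hinj, hadm, ε, hε, hgood⟩
  · -- naked case: some MGHD has incomplete 𝓘⁺; follow the visible incomplete ray
    obtain ⟨𝒟, h𝒟⟩ := not_forall.mp hC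
    obtain ⟨h𝒟max, hinc⟩ := Classical.not_imp.mp h𝒟
    obtain ⟨e, F, hF, hI, h0, hinj, hadm, ε, hε, hgood⟩ := hA X D hAdm ⟨𝒟, h𝒟max, hinc, by
      intro inst
      obtain ⟨γ, dom, hγ, halt⟩ := hN X D hAdm 𝒟 h𝒟max hinc
      have hnof := hF X D hAdm 𝒟 h𝒟max
      rcases halt with hpp | hkh
      · exact ⟨γ, dom, hγ, hpp⟩
      · exact (em _).elim (fun hpp ↦ ⟨γ, dom, hγ, hpp⟩)
          (fun hnpp ↦ absurd ⟨γ, dom, hγ, hnpp, hkh⟩ hnof)⟩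
    exact ⟨e, F, hF, hI, h0, hinj, hadm, ε, hε, hgood⟩

/-- Deprecated spelling: the rev-1 frame `MGHDExistence → LocalExitSuffices → NoFourthExit →
NoVacuumFountains → CurvatureModeExit → CensoredDataExit → FinalStateConjecture` (item
stmt-FinalStateConjecture-10214, retired 2026-08-16T23:16Z) stopped elaborating when the summit statement
was re-typed (T2, p126844: tame immersed genericity families, 5-conjunct good property); the repaired frame
for the current assembly item stmt-FinalStateConjecture-17756 is `CurvatureOrSymmetry.assemblyT2_frame_proof`. -/
@[deprecated CurvatureOrSymmetry.assemblyT2_frame_proof (since := "2026-08-16")]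
alias CurvatureOrSymmetry.assembly_frame_proof := CurvatureOrSymmetry.assemblyT2_frame_proof

end Summit.FinalStateConjecture.FinalStateConjecture.Theorems
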